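import Mathlib.NumberTheory.Padics.PadicIntegers
import Mathlib.NumberTheory.Padics.PadicVal.Basic
import HarnessLib

/-!
# Route `RamifiedHeegnerPair`, crux U₁ `LeafRankOneUpperAtThree` (stmt-BirchSwinnertonDyer-26022), line `partnerdescent` —
# partner kernel: from «`δ ∣ R` in `ℤ_[3]`» and «`R ∣ δ` in `ℕ`» to `ord₃ δ = ord₃ R` — the numerical end of the (G3♭ᶜ) derivation

HONEST FRAMING. Theorems only; helper file (`--supports stmt-BirchSwinnertonDyer-26022 --as helper`); elementary `p`-adic arithmetic over Mathlib;
no number theory of curves, no named fact, no `sorry`; nothing booked; BSD is proved for no curve. Lead prover bsd-line-rhp-p2 g63, 2026-08-31.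

WHY. The local run `LeafPartnerOrders.dvd_of_localRun` (‹…LeafPartnerOrdersLocalRun›, p811638) concludes `(δ : ℤ_[3]) ∣ R` for the natural numbers
`δ = δ_{D,M} = P.deg` and `R = ξ/i` (cast into `ℤ_[3]`), while Takahashi's Thm. 2.3 gives `δ = R·j`, so `R ∣ δ` in `ℕ`. The stub (G3♭ᶜ) wants
`¬ 3 ∣ j`, which by `LeafPartnerOrders.not_dvd_iff_padicValNat_eq` (p801913) is `padicValNat 3 δ = padicValNat 3 R`. This file is the bridge:
`padicValNat_le_of_natCast_dvd` («`(a : ℤ_[p]) ∣ b`, `b ≠ 0` ⟹ `ord_p a ≤ ord_p b`», via `‖b‖ ≤ ‖a‖ ≤ p^{-ord_p a}` and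
`PadicInt.norm_int_le_pow_iff_dvd`) and `padicValNat_eq_of_natCast_dvd_of_dvd`. [cite: Gouvea1993PadicNumbers, §3.3 (p-adic valuation and divisibility in ℤ_p)]
-/

set_option linter.dupNamespace false
set_option autoImplicit false

namespace Summit.BirchSwinnertonDyer.BirchSwinnertonDyer.Theorems.LeafPartnerOrders

variable {p : ℕ} [hp : Fact p.Prime]

/-- **`(a : ℤ_[p]) ∣ b` with `b ≠ 0` forces `ord_p a ≤ ord_p b`.** (`p^{ord_p a} ∣ a` in `ℤ`, so `‖a‖ ≤ p^{-ord_p a}`; divisibility in `ℤ_[p]`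
gives `‖b‖ ≤ ‖a‖`; and `‖b‖ ≤ p^{-n}` iff `p^n ∣ b`.) [cite: Gouvea1993PadicNumbers, §3.3] -/
theorem padicValNat_le_of_natCast_dvd {a b : ℕ} (hb : b ≠ 0) (h : (a : ℤ_[p]) ∣ (b : ℤ_[p])) :
    padicValNat p a ≤ padicValNat p b := by
  -- `‖a‖ ≤ p ^ (-ord_p a)`
  have ha : ‖((a : ℤ) : ℤ_[p])‖ ≤ (p : ℝ) ^ (-(padicValNat p a : ℤ)) := by
    rw [PadicInt.norm_int_le_pow_iff_dvd]
    exact_mod_cast (pow_padicValNat_dvd : p ^ padicValNat p a ∣ a)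
  -- `‖b‖ ≤ ‖a‖`
  obtain ⟨c, hc⟩ := h
  have hba : ‖((b : ℤ) : ℤ_[p])‖ ≤ ‖((a : ℤ) : ℤ_[p])‖ := by
    have hb' : ((b : ℤ) : ℤ_[p]) = ((a : ℤ) : ℤ_[p]) * c := by push_cast; exact_mod_cast hc
    rw [hb', norm_mul]
    exact mul_le_of_le_one_right (norm_nonneg _) (PadicInt.norm_le_one c)
  -- hence `p ^ (ord_p a) ∣ b`
  have hdvd : ((p ^ padicValNat p a : ℕ) : ℤ) ∣ (b : ℤ) := by
    have := PadicInt.norm_int_le_pow_iff_dvd.mp (hba.trans ha)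
    exact_mod_cast this
  have hdvd' : p ^ padicValNat p a ∣ b := by exact_mod_cast hdvd
  exact (padicValNat_dvd_iff_le hb).mp hdvd'

/-- **The numerical end of (G3♭ᶜ).** If `(δ : ℤ_[p]) ∣ R` (the local run, p811638) and `R ∣ δ` in `ℕ` (Takahashi: `δ = R·j`) with `δ ≠ 0`, then
`ord_p δ = ord_p R` — and `LeafPartnerOrders.not_dvd_iff_padicValNat_eq` (p801913) turns this into `p ∤ j`. [cite: Gouvea1993PadicNumbers, §3.3]
[cite: Takahashi2001, Thm. 2.3] -/
theorem padicValNat_eq_of_natCast_dvd_of_dvd {δ R : ℕ} (hδ : δ ≠ 0) (hδR : (δ : ℤ_[p]) ∣ (R : ℤ_[p])) (hRδ : R ∣ δ) :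
    padicValNat p δ = padicValNat p R := by
  have hR : R ≠ 0 := by
    rintro rfl
    exact hδ (Nat.eq_zero_of_zero_dvd hRδ)
  refine le_antisymm (padicValNat_le_of_natCast_dvd hR hδR) ?_
  obtain ⟨k, hk⟩ := hRδ
  have hk0 : k ≠ 0 := by rintro rfl; exact hδ (by rw [hk, mul_zero])
  rw [hk, padicValNat.mul hR hk0]
  exact Nat.le_add_right _ _

end Summit.BirchSwinnertonDyer.BirchSwinnertonDyer.Theorems.LeafPartnerOrders
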